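import Literature.AlgebraicGeometry.Resolution.LocalBlowup
import Literature.AlgebraicGeometry.Resolution.ExcellentRings
import Literature.AlgebraicGeometry.Resolution.ArithmeticalThreefoldsLocal
import Summits.ResolutionOfSingularities.ResolutionOfSingularities.Theses.FoliationDescent
import HarnessLib

/-!
# Crux `DescentPerfectToAll` (stmt-ResolutionOfSingularities-0549) — CENSUS `lens5_foliationBridge` (res-B-lens-5 g5, 2026-08-28)
# «transfer from the solved sibling»: the clean-descent step of line `via-cp-frame` TYPED valuation-wise through route `FoliationDescent`.

[OURS · CANDIDATE] counted 0; nothing here proves resolution in characteristic `p`.  Sorry-free; definitions + kernel bookkeeping only.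
NOT a registered skeleton (the slot of 0549 stays `Lines/via_clean_models.lean` rev 3); a typed census answering registrar res-B-lens-1
(bus 2026-08-28T21:41Z: «lens-5 lineage owns the typing of `CleanDescentAtDim` valuation-wise; one lemma, two customers»).

## The dictionary (Posva, arXiv:2405.05735, §4 proof of Thm 4.0.1 pp. 19–20, Prop. 2.2.2 p. 6–7, Prop. 3.3.1; Claim 5.1.2 p. 28; App. A p. 34)
base-side clean form of the radicand `a` at a regular model `A'` of `K₀`      ⟷  the rank-one `p`-closed derivation `D = d/dt` of `L = K₀(t)`, `t^p = a`,
                                                                                  is LOG-CANONICAL on a regular model of `L` above `A'`: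
  forms 2/3 (strictly clean: `A'[a^{1/p}]` regular)                            ⟷  `D` NON-SINGULAR (`D x` a unit for some `x`; Taylor projector, constants regular —
                                                                                  LANDED for ALL fields: `Theorems.…LogCanQuotLUNonsingularDescent.stub_nonsingularDescent`);
  form 1 (`u·∏ tᵢ^{aᵢ}`, some `p ∤ aᵢ`: `A'[a^{1/p}]^ν` toric)                     ⟷  `D` MULTIPLICATIVE (`D^p = u·D`, `u` unit; `μ_p`-type quotient, Posva 2311.16694 Prop. 11–12);
  Cossart's invariant `ν(x) = ord_x J(X,f,E)`, `J` = log-derivative ideal of `f`  ⟷  `clean_trichotomy_of_derivation_isUnit` (this line, rev 2.1).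

## The tooth of the transfer (what CP 2019 supplies over IMPERFECT fields)
Route `FoliationDescent` runs over PERFECT `k` because its regular top is the Frobenius top `A₀^{1/p}`, finitely generated over `k` iff `k` is
perfect (`Theses.FoliationDescent.DualSandwich`, docstring).  Over an arbitrary field the regular finitely generated top `R' ⊇ A₀[t]` of
`L = K₀(t)` along `ν_L` is exactly COVER-SIDE LU — printed in dimension 3 for all fields (`CossartPiltant2019Local` ⟹ `CpCoverLUAtDim 3`,
`cpCoverLUAtDim_three_of_local`, kernel) and OPEN for `n ≥ 4` (`CpCoverLUAtDim n`).  On `R'` the derivation `D = d/dt` (`K₀`-linear, `D t = 1`,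
`D^p = 0`, `L^D = K₀` — elementary, no Jacobson theorem needed) is a rank-one 1-foliation; `FolLU` + `LogCanQuotLU` WITHOUT `[PerfectField k]`
then produce a regular model of the constants `K₀` along `ν` with a clean read-off, i.e. `CleanLUAtDim n` (whose coefficient vector
`c : Fin p → K` allows any generator `x` of `L/K₀`: `x^p = ∑ c_j^p a^j`).  Hence the typed cut below:
  `CleanDescentAtDim n ⟸ CpAdapterAt n ∧ JacobsonBridgeAt n ∧ FolLUAllFieldsAt n ∧ CleanQuotLUAllFieldsAt n`   (`cleanDescentAtDim_of_foliationBridge`, kernel),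
with research content ONLY in `FolLUAllFieldsAt n` (OPEN for `n ≥ 3` even over `k̄` schematically: Posva 2405.05735 Remark 5.2.2 p. 30; stacks for
`p > 2`, Thm 5.2.1; `p = 2` perfect `k`, Thm 5.3.1) and in the multiplicative half of `CleanQuotLUAllFieldsAt n` (toric LU of `μ_p`-type quotients
over arbitrary residue fields, L-sized); `CpAdapterAt n` / `JacobsonBridgeAt n` are plumbing (M, no research content; unproved here).
ONE research statement, THREE customers: L1 `stub_cleanLU3` (imperfect part, `n = 3`), this line's S2′ (`n ≥ 4`), `FoliationDescent.FolLU` (perfect `k`).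

Dimension-3 status for the lead (STUBPLAN-cleanLU3-lens5.md): `stub_cleanLU3` = [`k = k̄`: PRINT, base-side — Cossart 1987 thèse + Posva 2405.05735
Claim 5.1.2 / App. A, étale-local form `t^p + x^a`] ⊕ [imperfect `k`: OPEN = `FolLUAllFieldsAt 3` fed by `CossartPiltant2019Local`].
-/

set_option linter.dupNamespace false

open CategoryTheory AlgebraicGeometry
open Literature.AlgebraicGeometry.Resolution

namespace Summit.ResolutionOfSingularities.ResolutionOfSingularities.Cruxes.DescentPerfectToAll.ViaCpFrame.FoliationBridge

/-! ## Verbatim copies (textually `rfl`) of the rev-2.3 decls of `Lines/via_cp_frame.lean` used below — kept textual so that this census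
elaborates standalone (crux line modules are not importable deps on the farm).  Namespace `…ViaCpFrame.FoliationBridge`. -/

/-- verbatim copy of `ViaCpFrame.CleanLUAtDim` (rev 2.3). [folklore] -/
def CleanLUAtDim (n : ℕ) : Prop :=
  ∀ (p : ℕ), p.Prime → ∀ (k : Type) [Field k] [CharP k p] (K : Type) [Field K] [Algebra k K]
    (O : ValuationSubring K) (A : Subalgebra k K), A.toSubring ≤ O.toSubring → A.FG → IsFractionRing A K →
    IsRegularLocalRing (locAtCentre A.toSubring O) →
    ringKrullDim (locAtCentre A.toSubring O) = (n : WithBot ℕ∞) →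
    ∀ g₀ : K, (∀ c : K, c ^ p ≠ g₀) →
    ∃ (A' : Subalgebra k K), A'.toSubring ≤ O.toSubring ∧ A ≤ A' ∧ A'.FG ∧
      ∃ (_ : IsRegularLocalRing (locAtCentre A'.toSubring O)) (c : Fin p → K),
        (∃ j : Fin p, (j : ℕ) ≠ 0 ∧ c j ≠ 0) ∧
        ((∃ (d m : ℕ) (hmd : m ≤ d) (t : Fin d → ↥(locAtCentre A'.toSubring O)) (a : Fin m → ℕ)
            (u : ↥(locAtCentre A'.toSubring O)), IsUnit u ∧
            Ideal.span (Set.range t) = IsLocalRing.maximalIdeal ↥(locAtCentre A'.toSubring O) ∧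
            ringKrullDim ↥(locAtCentre A'.toSubring O) = (d : WithBot ℕ∞) ∧ 0 < m ∧ (∀ i, ¬ p ∣ a i) ∧
            (∑ j : Fin p, c j ^ p * g₀ ^ (j : ℕ)) =
              (u : K) * ∏ i : Fin m, ((t (Fin.castLE hmd i) : ↥(locAtCentre A'.toSubring O)) : K) ^ (a i)) ∨
          (∃ u : ↥(locAtCentre A'.toSubring O), IsUnit u ∧ (∑ j : Fin p, c j ^ p * g₀ ^ (j : ℕ)) = (u : K) ∧
            ∀ c' : ↥(locAtCentre A'.toSubring O), u - c' ^ p ∉ IsLocalRing.maximalIdeal ↥(locAtCentre A'.toSubring O)) ∨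
          (∃ s c' : ↥(locAtCentre A'.toSubring O), (∑ j : Fin p, c j ^ p * g₀ ^ (j : ℕ)) = (s : K) ∧
            s - c' ^ p ∈ IsLocalRing.maximalIdeal ↥(locAtCentre A'.toSubring O) ∧
            s - c' ^ p ∉ IsLocalRing.maximalIdeal ↥(locAtCentre A'.toSubring O) ^ 2))

/-- verbatim copy of `ViaCpFrame.CpCoverLUAtDim` (rev 2.3). [cite: CossartPiltant2019, Thm. 1.5] -/
def CpCoverLUAtDim (n : ℕ) : Prop :=
  ∀ (p : ℕ), p.Prime →
  ∀ (S : Type) [CommRing S] [IsDomain S] [IsRegularLocalRing S],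
    IsExcellentRing S → ringKrullDim S = (n : WithBot ℕ∞) → CharP (IsLocalRing.ResidueField S) p →
  ∀ (K : Type) [Field K] [Algebra S K] [IsFractionRing S K]
    (L : Type) [Field L] [Algebra K L] [Algebra S L] [IsScalarTower S K L]
    (h : Polynomial S) (x : L),
    h.Monic → h.natDegree = p → Irreducible (h.map (algebraMap S K)) → Polynomial.aeval x h = 0 →
    Algebra.adjoin K ({x} : Set L) = ⊤ →
    (CharP K p ∧ ∀ i, 0 < i → i < p → h.coeff i = 0) →
  ∀ (O : ValuationSubring L), (∀ s : S, algebraMap S L s ∈ O) →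
    (∀ s ∈ IsLocalRing.maximalIdeal S, O.valuation (algebraMap S L s) < 1) →
    ∃ (t : Finset L) (ht : (Algebra.adjoin S (insert x (t : Set L))).toSubring ≤ O.toSubring),
      IsRegularLocalRing (Localization.AtPrime
        (Ideal.comap (Subring.inclusion ht) (IsLocalRing.maximalIdeal O)))

/-- verbatim copy of `ViaCpFrame.cpCoverLUAtDim_three_of_local` (rev 2.3, kernel). [cite: CossartPiltant2019, Thm. 1.5] -/
theorem cpCoverLUAtDim_three_of_local (H : Literature.AlgebraicGeometry.Resolution.CossartPiltant2019Local.{0}) : CpCoverLUAtDim 3 := by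
  intro p hp S _ _ _ hexc hdim hchar K _ _ _ L _ _ _ _ h x hmon hdeg hirr hx hadj hcase O hSO hdom
  have hdim3 : ringKrullDim S = 3 := by simpa using hdim
  exact H p hp S hexc hdim3 hchar K L h x hmon hdeg hirr hx hadj (Or.inl hcase) O hSO hdom

/-- verbatim copy of `ViaCpFrame.CleanDescentAtDim` (rev 2.3). [folklore] -/
def CleanDescentAtDim (n : ℕ) : Prop := CpCoverLUAtDim n → CleanLUAtDim n

/-- verbatim copy of `ViaCpFrame.cleanLUDimGEFour_of_cover_of_descent` (rev 2.3, kernel). [folklore] -/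
theorem cleanLUDimGEFour_of_cover_of_descent
    (hc : ∀ n : ℕ, 4 ≤ n → CpCoverLUAtDim n) (hd : ∀ n : ℕ, 4 ≤ n → CleanDescentAtDim n) :
    ∀ n : ℕ, 4 ≤ n → CleanLUAtDim n :=
  fun n hn => hd n hn (hc n hn)


/-- **`FolLU` over ALL ground fields** — `Theses.FoliationDescent.FolLU` (stmt-17081) with `[PerfectField k]` DROPPED, otherwise verbatim:
valuative log-canonical reduction of a nonzero `p`-closed `k`-derivation `D` of `K` on finitely generated tops regular at the centre, keeping the
top regular.  Known: dim 2 over `k̄` (Rudakov–Shafarevich 1976 Thm 1; Posva 2405.05735 Thm 4.0.1); OPEN from dim 3 (rank one on threefolds: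
Posva 2405.05735 Rem. 5.2.2 — schematic version open even over `k̄`; Thm 5.2.1 with tame DM stacks for `p > 2`; Thm 5.3.1 for `p = 2`, perfect `k`).
Why it might fail: an additive point reproducing (ord D, Jordan type, ord λ) along a valuation; imperfect residue fields at the centre add the
rung-B phenomenon. [cite: arXiv:2405.05735, Thm 4.0.1, Rem 5.2.2] [cite: RudakovShafarevich1976, Thm 1] -/
def FolLUAllFields : Prop :=
  ∀ p : ℕ, p.Prime → ∀ (k K : Type) [Field k] [CharP k p] [Field K] [Algebra k K] (O : ValuationSubring K)
    (S : Subalgebra k K) (hS : S.toSubring ≤ O.toSubring) (D : Derivation k K K), S.FG → IsFractionRing S K →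
    IsRegularLocalRing (Localization.AtPrime (Ideal.comap (Subring.inclusion hS) (IsLocalRing.maximalIdeal O))) →
    D ≠ 0 → (∃ c : K, ∀ x : K, (⇑D)^[p] x = c * D x) →
    ∃ (S' : Subalgebra k K) (h' : S'.toSubring ≤ O.toSubring) (g : K), S ≤ S' ∧ S'.FG ∧ IsFractionRing S' K ∧
      IsRegularLocalRing (Localization.AtPrime (Ideal.comap (Subring.inclusion h') (IsLocalRing.maximalIdeal O))) ∧ g ≠ 0 ∧
      (∀ x : K, (∃ a b : K, a ∈ S' ∧ b ∈ S' ∧ b ≠ 0 ∧ b⁻¹ ∈ O ∧ x = a / b) →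
        ∃ a b : K, a ∈ S' ∧ b ∈ S' ∧ b ≠ 0 ∧ b⁻¹ ∈ O ∧ (g • D) x = a / b) ∧
      ((∃ x : K, (∃ a b : K, a ∈ S' ∧ b ∈ S' ∧ b ≠ 0 ∧ b⁻¹ ∈ O ∧ x = a / b) ∧ (g • D) x ≠ 0 ∧ ((g • D) x)⁻¹ ∈ O) ∨
        (∃ u : K, (∃ a b : K, a ∈ S' ∧ b ∈ S' ∧ b ≠ 0 ∧ b⁻¹ ∈ O ∧ u = a / b) ∧ u ≠ 0 ∧ u⁻¹ ∈ O ∧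
          ∀ x : K, (⇑(g • D))^[p] x = u * (g • D) x))

/-- **`FolLU` over all fields AT TOPS OF LOCAL DIMENSION `n`** — the same with the extra hypothesis `dim S_c = n` (so that `n = 3` is the
imperfect part of L1's `stub_cleanLU3` and `n ≥ 4` serves S2′).  [cite: arXiv:2405.05735, Rem 5.2.2] -/
def FolLUAllFieldsAt (n : ℕ) : Prop :=
  ∀ p : ℕ, p.Prime → ∀ (k K : Type) [Field k] [CharP k p] [Field K] [Algebra k K] (O : ValuationSubring K)
    (S : Subalgebra k K) (hS : S.toSubring ≤ O.toSubring) (D : Derivation k K K), S.FG → IsFractionRing S K →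
    IsRegularLocalRing (Localization.AtPrime (Ideal.comap (Subring.inclusion hS) (IsLocalRing.maximalIdeal O))) →
    ringKrullDim (locAtCentre S.toSubring O) = (n : WithBot ℕ∞) →
    D ≠ 0 → (∃ c : K, ∀ x : K, (⇑D)^[p] x = c * D x) →
    ∃ (S' : Subalgebra k K) (h' : S'.toSubring ≤ O.toSubring) (g : K), S ≤ S' ∧ S'.FG ∧ IsFractionRing S' K ∧
      IsRegularLocalRing (Localization.AtPrime (Ideal.comap (Subring.inclusion h') (IsLocalRing.maximalIdeal O))) ∧ g ≠ 0 ∧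
      (∀ x : K, (∃ a b : K, a ∈ S' ∧ b ∈ S' ∧ b ≠ 0 ∧ b⁻¹ ∈ O ∧ x = a / b) →
        ∃ a b : K, a ∈ S' ∧ b ∈ S' ∧ b ≠ 0 ∧ b⁻¹ ∈ O ∧ (g • D) x = a / b) ∧
      ((∃ x : K, (∃ a b : K, a ∈ S' ∧ b ∈ S' ∧ b ≠ 0 ∧ b⁻¹ ∈ O ∧ x = a / b) ∧ (g • D) x ≠ 0 ∧ ((g • D) x)⁻¹ ∈ O) ∨
        (∃ u : K, (∃ a b : K, a ∈ S' ∧ b ∈ S' ∧ b ≠ 0 ∧ b⁻¹ ∈ O ∧ u = a / b) ∧ u ≠ 0 ∧ u⁻¹ ∈ O ∧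
          ∀ x : K, (⇑(g • D))^[p] x = u * (g • D) x))

/-- **Clean quotients uniformize, all fields, tops of local dimension `n`** — `Theses.FoliationDescent.LogCanQuotLU` (stmt-17082) with
`[PerfectField k]` dropped, `dim S'_c = n` added, and the CLEAN READ-OFF appended to the conclusion: the constants get a finitely generated
model `A ⊇ R` inside `O`, regular at the centre, AND some `x` with `D x ≠ 0` (so `K = K^D(x)`, `x^p ∈ K^D`) whose `p`-th power is loosely clean
(form 1 / 2 / 3 of `CleanLUAtDim`) at `A_c`.  Non-singular half: constants `S' ∩ K^D` regular is LANDED for all fields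
(`Theorems.…LogCanQuotLUNonsingularDescent.stub_nonsingularDescent`); read-off = embedding-dimension count for `B[X]/(X^p − x^p)` regular
(form 2/3).  Multiplicative half: `μ_p`-type toric quotient, read-off form 1 after a toric local blow-up inside `K^D` (L-sized; printed at closed
points over `k̄`, Posva 2311.16694 Prop. 11–12).  Why it might fail: non-closed centres / imperfect residue fields need an étale-descended toric
uniformization of the constants; the Zariski (not henselian) form-1 read-off may cost extra blow-ups. [cite: arXiv:2311.16694, Prop 11-12]
[cite: RudakovShafarevich1976, Thm 1-2] -/
def CleanQuotLUAllFieldsAt (n : ℕ) : Prop :=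
  ∀ p : ℕ, p.Prime → ∀ (k K : Type) [Field k] [CharP k p] [Field K] [Algebra k K] (O : ValuationSubring K)
    (S' : Subalgebra k K) (h' : S'.toSubring ≤ O.toSubring) (D : Derivation k K K) (g : K) (R : Subalgebra k K),
    S'.FG → IsFractionRing S' K →
    IsRegularLocalRing (Localization.AtPrime (Ideal.comap (Subring.inclusion h') (IsLocalRing.maximalIdeal O))) →
    ringKrullDim (locAtCentre S'.toSubring O) = (n : WithBot ℕ∞) →
    D ≠ 0 → (∃ c : K, ∀ x : K, (⇑D)^[p] x = c * D x) → g ≠ 0 →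
    (∀ x : K, (∃ a b : K, a ∈ S' ∧ b ∈ S' ∧ b ≠ 0 ∧ b⁻¹ ∈ O ∧ x = a / b) →
      ∃ a b : K, a ∈ S' ∧ b ∈ S' ∧ b ≠ 0 ∧ b⁻¹ ∈ O ∧ (g • D) x = a / b) →
    ((∃ x : K, (∃ a b : K, a ∈ S' ∧ b ∈ S' ∧ b ≠ 0 ∧ b⁻¹ ∈ O ∧ x = a / b) ∧ (g • D) x ≠ 0 ∧ ((g • D) x)⁻¹ ∈ O) ∨
      (∃ u : K, (∃ a b : K, a ∈ S' ∧ b ∈ S' ∧ b ≠ 0 ∧ b⁻¹ ∈ O ∧ u = a / b) ∧ u ≠ 0 ∧ u⁻¹ ∈ O ∧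
        ∀ x : K, (⇑(g • D))^[p] x = u * (g • D) x)) →
    R.FG → R ≤ S' → (∀ x ∈ R, D x = 0) →
    ∃ (A : Subalgebra k K) (hA : A.toSubring ≤ O.toSubring), R ≤ A ∧ A.FG ∧ (∀ x ∈ A, D x = 0) ∧
      (∀ x : K, D x = 0 → ∃ a b : K, a ∈ A ∧ b ∈ A ∧ b ≠ 0 ∧ x = a / b) ∧
      ∃ (_ : IsRegularLocalRing (locAtCentre A.toSubring O)) (x : K), D x ≠ 0 ∧
        ((∃ (d m : ℕ) (hmd : m ≤ d) (t : Fin d → ↥(locAtCentre A.toSubring O)) (a : Fin m → ℕ)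
            (u : ↥(locAtCentre A.toSubring O)), IsUnit u ∧
            Ideal.span (Set.range t) = IsLocalRing.maximalIdeal ↥(locAtCentre A.toSubring O) ∧
            ringKrullDim ↥(locAtCentre A.toSubring O) = (d : WithBot ℕ∞) ∧ 0 < m ∧ (∀ i, ¬ p ∣ a i) ∧
            x ^ p = (u : K) * ∏ i : Fin m, ((t (Fin.castLE hmd i) : ↥(locAtCentre A.toSubring O)) : K) ^ (a i)) ∨
          (∃ u : ↥(locAtCentre A.toSubring O), IsUnit u ∧ x ^ p = (u : K) ∧
            ∀ c' : ↥(locAtCentre A.toSubring O), u - c' ^ p ∉ IsLocalRing.maximalIdeal ↥(locAtCentre A.toSubring O)) ∨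
          (∃ s c' : ↥(locAtCentre A.toSubring O), x ^ p = (s : K) ∧
            s - c' ^ p ∈ IsLocalRing.maximalIdeal ↥(locAtCentre A.toSubring O) ∧
            s - c' ^ p ∉ IsLocalRing.maximalIdeal ↥(locAtCentre A.toSubring O) ^ 2))

/-- **Cover-side LU in the valuation / `k`-subalgebra phrasing, base centres of dimension `n`** — the adapter target for `CpCoverLUAtDim n`:
`k` any field of characteristic `p`, `K ⊆ L = K(y)` with `y^p = g₀ ∉ K^p`, `O` a valuation ring of `L`, `A ⊆ O ∩ K` finitely generated with
`Frac A = K`, regular of dimension `n` at the centre; then some finitely generated `S' ⊆ O` with `A[y] ⊆ S'`, `Frac S' = L`, regular at the centre.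
For `n = 3` this is `CossartPiltant2019`, Thm 1.5 (i) read along `ν` (the tree's `CossartPiltant2019Local`); OPEN for `n ≥ 4`.
[cite: CossartPiltant2019, Thm. 1.5] -/
def CoverLUAlongAt (n : ℕ) : Prop :=
  ∀ p : ℕ, p.Prime → ∀ (k K : Type) [Field k] [CharP k p] [Field K] [Algebra k K]
    (L : Type) [Field L] [Algebra K L] [Algebra k L] [IsScalarTower k K L]
    (O : ValuationSubring L) (A : Subalgebra k K)
    (hA : (A.map (IsScalarTower.toAlgHom k K L)).toSubring ≤ O.toSubring),
    A.FG → IsFractionRing A K →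
    IsRegularLocalRing (locAtCentre (A.map (IsScalarTower.toAlgHom k K L)).toSubring O) →
    ringKrullDim (locAtCentre (A.map (IsScalarTower.toAlgHom k K L)).toSubring O) = (n : WithBot ℕ∞) →
    ∀ (g₀ : K) (y : L), (∀ c : K, c ^ p ≠ g₀) → y ^ p = algebraMap K L g₀ → Algebra.adjoin K ({y} : Set L) = ⊤ →
    ∃ (S' : Subalgebra k L) (h' : S'.toSubring ≤ O.toSubring),
      A.map (IsScalarTower.toAlgHom k K L) ≤ S' ∧ y ∈ S' ∧ S'.FG ∧ IsFractionRing S' L ∧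
      IsRegularLocalRing (Localization.AtPrime (Ideal.comap (Subring.inclusion h') (IsLocalRing.maximalIdeal O)))

/-- **Adapter** (plumbing, no research content; unproved here): the abstract-ring statement `CpCoverLUAtDim n` (excellent regular local `S`,
`h = X^p − g₀`) specialises to `CoverLUAlongAt n` (`S := A_c` is essentially of finite type over `k`, hence excellent; `O_L` is the unique
extension; the finite set `t` of the conclusion generates `S'`). [folklore] -/
def CpAdapterAt (n : ℕ) : Prop := CpCoverLUAtDim n → CoverLUAlongAt n

/-- **Jacobson bridge** (plumbing + the elementary set-up, unproved here; M-sized, no research content): from `CoverLUAlongAt n` (regular f.g.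
top `S' ∋ y` of `L = K(y)`), the `K`-derivation `D = d/dy` of `L` (`D y = 1`, `D^p = 0`, `L^D = K`), `FolLUAllFieldsAt n` (applied on `L` to
`(S', D)`) and `CleanQuotLUAllFieldsAt n` (applied with `R :=` the image of `A`), read the clean conclusion of `CleanLUAtDim n` back in `K`
(`x^p = ∑ c_j^p g₀^j` with `c : Fin p → K`, `c ≠ 0` off `j = 0` because `D x ≠ 0`; transport of `A`, `O ∩ K`, regularity and the three forms
along `algebraMap K L`). [folklore] -/
def JacobsonBridgeAt (n : ℕ) : Prop := CoverLUAlongAt n → FolLUAllFieldsAt n → CleanQuotLUAllFieldsAt n → CleanLUAtDim n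

/-! ## Kernel bookkeeping -/

/-- Dropping `[PerfectField k]` is a strengthening: the all-fields statement gives route FoliationDescent's crux `FolLU` (stmt-17081). [folklore] -/
theorem folLU_of_folLUAllFields (h : FolLUAllFields) :
    Summit.ResolutionOfSingularities.ResolutionOfSingularities.Theses.FoliationDescent.FolLU := by
  intro p hp k K _ _ _ _ _ O S hS D hfg hfrac hreg hD hpc
  exact h p hp k K O S hS D hfg hfrac hreg hD hpc

/-- … and restricts to every local dimension. [folklore] -/
theorem folLUAllFieldsAt_of_folLUAllFields (h : FolLUAllFields) (n : ℕ) : FolLUAllFieldsAt n := by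
  intro p hp k K _ _ _ _ O S hS D hfg hfrac hreg _hdim hD hpc
  exact h p hp k K O S hS D hfg hfrac hreg hD hpc

/-- **The typed cut of the clean-descent step**: adapter, bridge, all-fields foliation LU and clean quotient LU at dimension `n` give
`CleanDescentAtDim n` (= `CpCoverLUAtDim n → CleanLUAtDim n`). Pure composition. [folklore] -/
theorem cleanDescentAtDim_of_foliationBridge (n : ℕ)
    (ha : CpAdapterAt n) (hj : JacobsonBridgeAt n) (hf : FolLUAllFieldsAt n) (hq : CleanQuotLUAllFieldsAt n) :
    CleanDescentAtDim n :=
  fun hc => hj (ha hc) hf hq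

/-- **Customer S2′ (`n ≥ 4`)**: with cover-LU in every dimension `≥ 4`, the bridge data give clean LU in every dimension `≥ 4` (β re-typed),
via the rev-2.3 bookkeeping `cleanLUDimGEFour_of_cover_of_descent`. [folklore] -/
theorem cleanLUDimGEFour_of_foliationBridge
    (hc : ∀ n : ℕ, 4 ≤ n → CpCoverLUAtDim n) (ha : ∀ n : ℕ, 4 ≤ n → CpAdapterAt n)
    (hj : ∀ n : ℕ, 4 ≤ n → JacobsonBridgeAt n) (hf : FolLUAllFields) (hq : ∀ n : ℕ, 4 ≤ n → CleanQuotLUAllFieldsAt n) :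
    ∀ n : ℕ, 4 ≤ n → CleanLUAtDim n :=
  cleanLUDimGEFour_of_cover_of_descent hc
    (fun n hn => cleanDescentAtDim_of_foliationBridge n (ha n hn) (hj n hn) (folLUAllFieldsAt_of_folLUAllFields hf n) (hq n hn))

/-- **Customer L1 (`n = 3`, the lead's `stub_cleanLU3` in the `CleanLUAtDim 3` shape)**: the printed cover-side theorem
`CossartPiltant2019Local` (all fields) plus the dimension-3 bridge data give clean LU at three-dimensional centres over ALL fields; the only
research-grade input is `FolLUAllFieldsAt 3` (+ the multiplicative half of `CleanQuotLUAllFieldsAt 3`). [cite: CossartPiltant2019, Thm. 1.5] -/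
theorem cleanLUAtDim_three_of_foliationBridge
    (H : Literature.AlgebraicGeometry.Resolution.CossartPiltant2019Local.{0})
    (ha : CpAdapterAt 3) (hj : JacobsonBridgeAt 3) (hf : FolLUAllFieldsAt 3) (hq : CleanQuotLUAllFieldsAt 3) :
    CleanLUAtDim 3 :=
  cleanDescentAtDim_of_foliationBridge 3 ha hj hf hq (cpCoverLUAtDim_three_of_local H)

/-- **Customer L1, verbatim**: `CleanLUAtDim 3` implies the statement of the lead's registered stub `CleanModels.Sketch.stub_cleanLU3` (rev 16;
signature = hypothesis `hLU` of the landed 4a `stub_cleanCharts3`, p669538) — the extra hypothesis `ringKrullDim A ≤ 3` is idle and the numeral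
`3` is the cast of `(3 : ℕ)`.  Kernel bookkeeping. [folklore] -/
theorem stub_cleanLU3_statement_of_cleanLUAtDim_three (h : CleanLUAtDim 3) :
    ∀ (p : ℕ), p.Prime →
    ∀ (k : Type) [Field k] [CharP k p] (K : Type) [Field K] [Algebra k K]
    (O : ValuationSubring K) (A : Subalgebra k K), A.toSubring ≤ O.toSubring → A.FG → IsFractionRing A K →
    ringKrullDim A ≤ 3 → IsRegularLocalRing (locAtCentre A.toSubring O) →
    ringKrullDim (locAtCentre A.toSubring O) = 3 →
    ∀ g₀ : K, (∀ c : K, c ^ p ≠ g₀) →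
    ∃ (A' : Subalgebra k K), A'.toSubring ≤ O.toSubring ∧ A ≤ A' ∧ A'.FG ∧
    ∃ (_ : IsRegularLocalRing (locAtCentre A'.toSubring O)) (c : Fin p → K), (∃ j : Fin p, (j : ℕ) ≠ 0 ∧ c j ≠ 0) ∧
    ((∃ (d m : ℕ) (hmd : m ≤ d) (t : Fin d → ↥(locAtCentre A'.toSubring O)) (a : Fin m → ℕ) (u : ↥(locAtCentre A'.toSubring O)), IsUnit u ∧
    Ideal.span (Set.range t) = IsLocalRing.maximalIdeal ↥(locAtCentre A'.toSubring O) ∧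
    ringKrullDim ↥(locAtCentre A'.toSubring O) = (d : WithBot ℕ∞) ∧ 0 < m ∧ (∀ i, ¬ p ∣ a i) ∧
    (∑ j : Fin p, c j ^ p * g₀ ^ (j : ℕ)) = (u : K) * ∏ i : Fin m, ((t (Fin.castLE hmd i) : ↥(locAtCentre A'.toSubring O)) : K) ^ (a i)) ∨
    (∃ u : ↥(locAtCentre A'.toSubring O), IsUnit u ∧ (∑ j : Fin p, c j ^ p * g₀ ^ (j : ℕ)) = (u : K) ∧
    ∀ c' : ↥(locAtCentre A'.toSubring O), u - c' ^ p ∉ IsLocalRing.maximalIdeal ↥(locAtCentre A'.toSubring O)) ∨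
    (∃ s c' : ↥(locAtCentre A'.toSubring O), (∑ j : Fin p, c j ^ p * g₀ ^ (j : ℕ)) = (s : K) ∧
    s - c' ^ p ∈ IsLocalRing.maximalIdeal ↥(locAtCentre A'.toSubring O) ∧
    s - c' ^ p ∉ IsLocalRing.maximalIdeal ↥(locAtCentre A'.toSubring O) ^ 2)) := by
  intro p hp k _ _ K _ _ O A hAO hfg hfrac _hle hreg hdim g₀ hg₀
  have hdim' : ringKrullDim (locAtCentre A.toSubring O) = ((3 : ℕ) : WithBot ℕ∞) := by
    rw [hdim]; norm_cast
  exact h p hp k K O A hAO hfg hfrac hreg hdim' g₀ hg₀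

end Summit.ResolutionOfSingularities.ResolutionOfSingularities.Cruxes.DescentPerfectToAll.ViaCpFrame.FoliationBridge
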